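/-
Copyright (c) 2026 the pub-hodgecm-mathlib formalisation cell (harness21).  Prover seat hodgecm-mathlib-K2E4-p08 (g2), Track B «K2-LIT» ∕ h413,
‹S› ROAD J (K2E3-plan (g1) BATCH #3: road of record), brick J1 «VALUE OF THE DESCENDED FUNCTION AT THE CENTRE».  2026-09-03.
-/
import Literature.NumberTheory.Rogawski1990.LocalTransferCentralSingularDescentCM    -- ★ p842098 (A-p14): the descent whose proof is replayed here (all its ★ bricks come with it)
import Literature.NumberTheory.Automorphic.OrbitalMeasureCentralMass                  -- ★ central-class bookkeeping (importers of the value read it with `orbitalIntegral_of_forall_comm`)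
import HarnessLib

/-!
# ‹S› road J, brick J1: HARISH-CHANDRA DESCENT AT THE CENTRAL SINGULAR POINT `ε_H = (a·1₂, u)` WITH THE VALUE OF THE DESCENDED FUNCTION AT THE CENTRE
# `ψ_ε(ε_H) = O_ε(ψ; ν_G ∕ θ_*ν_H)` (Rogawski 1990 §8.2 Prop. 8.2.1 (a); Harish-Chandra (van Dijk) I §3; Langlands–Shelstad, Descent §2.4)

Cell `pub/hodgecm-mathlib` (D-0151), crux H413 = `stmt-HodgeConjecture-24833`, Track B «K2-LIT»; E4 socket #8 `sig_K2E4KottwitzSignOfSheets` ⟸ ‹S› `sig_K2E3SingularTransferSigned`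
(OWNER K2E3, countersigned 22:41:30Z; ROAD J adopted 22:57:30Z: ‹S› = the VALUE at `ε_H` of Track A's ★ S1-dress transfer `φ^H = Δ₀·ψ_ε + Δ₁·κ(φ)·f_EP^H` + density).
THEOREMS ONLY (no definition, no instance, no notation, no named fact, no `sorry`); lane `--supports stmt-HodgeConjecture-24833 --as helper`.

★ `LocalTransferCentralSingularDescentCM.exists_nhds_classOrbitalIntegral_dock_eq_of_isLocSmooth` (p842098) proves, for every `ψ ∈ C_c^∞(G′_v)`, the EXISTENCE of a stably
saturated `B ∈ 𝓝 ε_H` and of `ψ_ε ∈ C_c^∞(H_v)` with `Φ(⟦θ h⟧, ψ; m_G) = Φ(⟦h⟧, ψ_ε; m_H)` for `G`-regular `h ∈ B` — but its `∃ ψ_ε` forgets the witness `ψ_ε = ψ_M ∘ θ`,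
`ψ_M(m) = ∫ β(x) ψ(x m x⁻¹) dν_G` (`β` Harish-Chandra's cut-off ★ `ConjugationCutoff`) and with it the VALUE AT THE CENTRE.  Road J's assembly of ‹S› (K2E4-p06 (g2)) needs
exactly that value: `f^H(ε_H) = Δ₀·ψ_ε(ε_H) + (compact side)`.  THIS FILE replays p842098's proof VERBATIM for a general smooth `ψ` and ADDS the conjunct
  `ψ_ε(ε_H) = O_ε(ψ; quotientMeasure Z(ε) (θ_* ν_H) ν_G)`
(for ANY name `νM` of the transported Haar measure `θ_* ν_H` on `Z(ε)`): `θ ε_H = ε`, so `ψ_ε(ε_H) = ψ_M(ε) = ∫_G β(x) ψ(xεx⁻¹) dν_G`, and the cut-off's normalisation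
`∫_{Z(ε)} β(c k₀ h) d(θ_*ν_H)(h) = 1` on `C·Z(ε) ⊇ {x : xεx⁻¹ ∈ supp ψ}` (★ W2 at `h = ε_H`) turns the quotient integral formula ★ `integral_fiberIntegral_quotientMeasure`
(Deitmar–Echterhoff Thm. 1.5.3) into `= ∫_{G∕Z(ε)} ψ(ẋ ε ẋ⁻¹) d(ν_G ∕ θ_*ν_H)` — §1 `integral_smul_conj_eq_orbitalIntegral_of_cutoff` (generic, real and imaginary parts separately;
integrability of the orbital integrand from the CLOSED orbit of `ε`, hypothesis `hO` — at the dock point `ε = y·ι_v(ε_H)·y⁻¹`, `(ε − a)(ε − u) = 0` with `a − u` a unit, it is ★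
`isClosed_conjClass_local_of_mul_sub_smul_eq_zero`).
[Rogawski1990 §8.2 Prop. 8.2.1 (a) p. 118 ⟸ Prop. 8.1.3 pp. 116–117; HarishChandra1970 Part I §3 Lemmas 19–23; LanglandsShelstad1990Descent §2.4; DeitmarEchterhoff2014 Thm. 1.5.3.]

* §1 `integral_smul_conj_eq_orbitalIntegral_of_cutoff` (generic locally compact group).
* §2 **`exists_nhds_classOrbitalIntegral_dock_eq_and_apply_centre`** — p842098's binders VERBATIM + `hO` (closed orbit of `ε`); conclusion = p842098's ∧ the value conjunct.

HONEST LABEL: HC_CM is proved only modulo the 7 printed citations (2 remaining named inputs: hLiu418 = stmt-HodgeConjecture-24832, h413 = stmt-HodgeConjecture-24833) until rung 0 closes; this file moves no counter (J1 of road J; J2♯, J3, J4, J5 pending).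

## References
* [Rogawski1990] J. D. Rogawski, *Automorphic Representations of Unitary Groups in Three Variables*, Ann. of Math. Stud. 123 (1990), §8.2 Prop. 8.2.1 (a) p. 118; §8.1 pp. 116–117; §4.3 (4.3.1) p. 43.
* [HarishChandra1970] Harish-Chandra (notes by G. van Dijk), *Harmonic Analysis on Reductive p-adic Groups*, LNM 162 (1970), Part I §3, Lemmas 19–23.
* [LanglandsShelstad1990Descent] R. P. Langlands, D. Shelstad, *Descent for transfer factors*, The Grothendieck Festschrift II (1990), §2.4.
* [DeitmarEchterhoff2014] A. Deitmar, S. Echterhoff, *Principles of Harmonic Analysis*, 2nd ed. (2014), Thm. 1.5.3.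
-/

set_option autoImplicit false
set_option linter.dupNamespace false

noncomputable section

open Set Filter Topology MeasureTheory MeasureTheory.Measure
open scoped Pointwise Matrix

namespace Summit.HodgeConjecture.HodgeConjecture.Cruxes.H413.K2E3SingularDescentValueAtCentre

open Literature.NumberTheory.Rogawski1990

open Literature.NumberTheory.Automorphic Literature.NumberTheory.Automorphic.UnitaryGroup Literature.MeasureTheory.Group
open _root_.NumberField _root_.IsDedekindDomain


/-! ## §1 Generic: the cut-off integral at a point IS the orbital integral there (Harish-Chandra's normalisation read at the centre) -/

section Cutoff

variable {G : Type*} [Group G] [TopologicalSpace G] [IsTopologicalGroup G] [LocallyCompactSpace G] [SecondCountableTopology G] [T2Space G]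
  [MeasurableSpace G] [BorelSpace G]

/-- **`∫_G β(x)·ψ(xγx⁻¹) dν = O_γ(ψ; ν ∕ ρ)` for a cut-off `β` normalised along `Z(γ)`** (`∫_{Z(γ)} β(c k₀ h) dρ(h) = 1` for `c ∈ C`, `k₀ ∈ Z(γ)`, where
`xγx⁻¹ ∈ supp ψ ⇒ x ∈ C·Z(γ)`): the quotient integral formula (★ `integral_fiberIntegral_quotientMeasure`) applied to `β · (u ∘ Ad(·)γ)` for `u = Re ψ, Im ψ`,
whose fibre integral along `Z(γ)` is `u(xγx⁻¹) · ∫ β(x h) dρ(h) = u(xγx⁻¹)` on `C·Z(γ)` and `0 = u(xγx⁻¹)` off it; the orbit of `γ` is closed so that the orbital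
integrand is integrable (★ `integrable_descConj_of_isClosed`). [cite: HarishChandra1970, Part I §3 Lemmas 19–23] [cite: DeitmarEchterhoff2014, Thm. 1.5.3] -/
theorem integral_smul_conj_eq_orbitalIntegral_of_cutoff (γ : G) (hO : IsClosed {g : G | ∃ x : G, x * γ * x⁻¹ = g})
    [MeasurableSpace (G ⧸ Subgroup.centralizer ({γ} : Set G))] [BorelSpace (G ⧸ Subgroup.centralizer ({γ} : Set G))]
    (ρ : Measure ↥(Subgroup.centralizer ({γ} : Set G))) [ρ.IsHaarMeasure] [ρ.IsInvInvariant]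
    (ν : Measure G) [IsFiniteMeasureOnCompacts ν] [ν.IsMulRightInvariant]
    {C : Set G} {β : G → ℝ} (hβc : Continuous β) (hβs : HasCompactSupport β)
    (hβ1 : ∀ c ∈ C, ∀ k₀ : ↥(Subgroup.centralizer ({γ} : Set G)), ∫ h : ↥(Subgroup.centralizer ({γ} : Set G)), β (c * (k₀ : G) * (h : G)) ∂ρ = 1)
    {ψ : G → ℂ} (hψc : Continuous ψ) (hψs : HasCompactSupport ψ)
    (hCM : ∀ x : G, x * γ * x⁻¹ ∈ tsupport ψ → x ∈ C * ((Subgroup.centralizer ({γ} : Set G) : Subgroup G) : Set G)) :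
    ∫ x, β x • ψ (x * γ * x⁻¹) ∂ν =
      orbitalIntegral γ ψ (quotientMeasure (Subgroup.centralizer ({γ} : Set G)) ρ (isClosed_coe_centralizer_singleton γ) ν) := by
  have hZc : IsClosed (((Subgroup.centralizer ({γ} : Set G)) : Subgroup G) : Set G) := isClosed_coe_centralizer_singleton γ
  haveI : LocallyCompactSpace ↥(Subgroup.centralizer ({γ} : Set G)) := hZc.isClosedEmbedding_subtypeVal.locallyCompactSpace
  -- the conjugation map and the complex integrand
  have hconj : Continuous fun x : G => x * γ * x⁻¹ := (continuous_id.mul continuous_const).mul continuous_id.inv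
  have hint : Integrable (fun x => β x • ψ (x * γ * x⁻¹)) ν :=
    Continuous.integrable_of_hasCompactSupport (hβc.smul (hψc.comp hconj)) (hβs.smul_right)
  have hintq : Integrable (descConj γ (Subgroup.centralizer ({γ} : Set G)) (fun _ hg => Subgroup.mem_centralizer_singleton_iff.1 hg) ψ)
      (quotientMeasure (Subgroup.centralizer ({γ} : Set G)) ρ hZc ν) :=
    integrable_descConj_of_isClosed γ hO hψc hψs _
  -- the quotient integral formula for `β · (u ∘ Ad(·)γ)`, `u : ℂ → ℝ` continuous real-linear read-out (`re`, `im`)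
  have key : ∀ (u : ℂ → ℝ), Continuous u → u 0 = 0 →
      ∫ y, u (descConj γ (Subgroup.centralizer ({γ} : Set G)) (fun _ hg => Subgroup.mem_centralizer_singleton_iff.1 hg) ψ y)
          ∂(quotientMeasure (Subgroup.centralizer ({γ} : Set G)) ρ hZc ν) = ∫ x, β x * u (ψ (x * γ * x⁻¹)) ∂ν := by
    intro u hu hu0
    have hfc : Continuous fun x : G => β x * u (ψ (x * γ * x⁻¹)) := hβc.mul (hu.comp (hψc.comp hconj))
    have hfs : HasCompactSupport fun x : G => β x * u (ψ (x * γ * x⁻¹)) := hβs.mul_right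
    set f : CompactlySupportedContinuousMap G ℝ := ⟨⟨fun x : G => β x * u (ψ (x * γ * x⁻¹)), hfc⟩, hfs⟩ with hfdef
    -- the fibre integral of `f` along `Z(γ)` is the orbital integrand of `u ∘ ψ`
    have hfib : ∀ x : G, fiberIntegral (Subgroup.centralizer ({γ} : Set G)) ρ f (QuotientGroup.mk x) = u (ψ (x * γ * x⁻¹)) := by
      intro x
      rw [fiberIntegral_mk]
      have hin : ∀ h : ↥(Subgroup.centralizer ({γ} : Set G)), (f : G → ℝ) (x * (h : G)) = β (x * (h : G)) * u (ψ (x * γ * x⁻¹)) := by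
        intro h
        have hh : (h : G) * γ = γ * (h : G) := Subgroup.mem_centralizer_singleton_iff.1 h.2
        have hc' : x * (h : G) * γ * (x * (h : G))⁻¹ = x * γ * x⁻¹ := by
          rw [mul_inv_rev, mul_assoc x (h : G) γ, hh, ← mul_assoc x γ (h : G), mul_assoc (x * γ) (h : G) ((h : G)⁻¹ * x⁻¹),
            ← mul_assoc (h : G) (h : G)⁻¹ x⁻¹, mul_inv_cancel, one_mul]
        change β (x * (h : G)) * u (ψ (x * (h : G) * γ * (x * (h : G))⁻¹)) = _
        rw [hc']
      simp_rw [hin]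
      rw [integral_mul_const]
      by_cases hx : x ∈ C * (((Subgroup.centralizer ({γ} : Set G)) : Subgroup G) : Set G)
      · obtain ⟨c, hc, k₀, hk₀, rfl⟩ := Set.mem_mul.1 hx
        rw [hβ1 c hc ⟨k₀, hk₀⟩, one_mul]
      · have h0 : ψ (x * γ * x⁻¹) = 0 := by
          by_contra hne
          exact hx (hCM x (subset_tsupport _ hne))
        rw [h0, hu0, mul_zero]
    have hcongr : (fun y => u (descConj γ (Subgroup.centralizer ({γ} : Set G)) (fun _ hg => Subgroup.mem_centralizer_singleton_iff.1 hg) ψ y)) =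
        fun y => fiberIntegral (Subgroup.centralizer ({γ} : Set G)) ρ f y := by
      funext y
      obtain ⟨x, rfl⟩ := QuotientGroup.mk_surjective y
      rw [descConj_mk, hfib]
    rw [hcongr, integral_fiberIntegral_quotientMeasure]
    rfl
  -- assemble real and imaginary parts
  rw [orbitalIntegral_eq_integral_descConj]
  apply Complex.ext
  · have h1 := integral_re hint
    have h2 := integral_re hintq
    simp only [RCLike.re_to_complex] at h1 h2
    rw [← h1, ← h2, key Complex.re Complex.continuous_re Complex.zero_re]
    refine integral_congr_ae (Eventually.of_forall fun x => ?_)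
    simp only [Complex.real_smul, Complex.mul_re, Complex.ofReal_re, Complex.ofReal_im, zero_mul, sub_zero]
  · have h1 := integral_im hint
    have h2 := integral_im hintq
    simp only [RCLike.im_to_complex] at h1 h2
    rw [← h1, ← h2, key Complex.im Complex.continuous_im Complex.zero_im]
    refine integral_congr_ae (Eventually.of_forall fun x => ?_)
    simp only [Complex.real_smul, Complex.mul_im, Complex.ofReal_re, Complex.ofReal_im, zero_mul, add_zero]

end Cutoff


/-! ## §2 The descent with the value at the centre -/

section CentralSingularDescent

variable (L : Type) [Field L] [NumberField L] [IsCMField L] (H' : Matrix (Fin 3) (Fin 3) L) (v : HeightOneSpectrum (𝓞 ↥(maximalRealSubfield L)))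

variable [MeasurableSpace ((cmDatum L 3 H').Local v)] [BorelSpace ((cmDatum L 3 H').Local v)] [MeasurableSpace ((cmDatum L 2 (Matrix.of fun i j : Fin 2 => if i.val + j.val + 1 = 2 then (1 : L) else 0)).Local v × (cmDatum L 1 (Matrix.of fun i j : Fin 1 => if i.val + j.val + 1 = 1 then (1 : L) else 0)).Local v)] [BorelSpace ((cmDatum L 2 (Matrix.of fun i j : Fin 2 => if i.val + j.val + 1 = 2 then (1 : L) else 0)).Local v × (cmDatum L 1 (Matrix.of fun i j : Fin 1 => if i.val + j.val + 1 = 1 then (1 : L) else 0)).Local v)]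
  [iG : ∀ γ : ((cmDatum L 3 H').Local v), MeasurableSpace (((cmDatum L 3 H').Local v) ⧸ Subgroup.centralizer ({γ} : Set ((cmDatum L 3 H').Local v)))]
  [bG : ∀ γ : ((cmDatum L 3 H').Local v), BorelSpace (((cmDatum L 3 H').Local v) ⧸ Subgroup.centralizer ({γ} : Set ((cmDatum L 3 H').Local v)))]
  [iH : ∀ a : ((cmDatum L 2 (Matrix.of fun i j : Fin 2 => if i.val + j.val + 1 = 2 then (1 : L) else 0)).Local v × (cmDatum L 1 (Matrix.of fun i j : Fin 1 => if i.val + j.val + 1 = 1 then (1 : L) else 0)).Local v), MeasurableSpace (((cmDatum L 2 (Matrix.of fun i j : Fin 2 => if i.val + j.val + 1 = 2 then (1 : L) else 0)).Local v × (cmDatum L 1 (Matrix.of fun i j : Fin 1 => if i.val + j.val + 1 = 1 then (1 : L) else 0)).Local v) ⧸ Subgroup.centralizer ({a} : Set ((cmDatum L 2 (Matrix.of fun i j : Fin 2 => if i.val + j.val + 1 = 2 then (1 : L) else 0)).Local v × (cmDatum L 1 (Matrix.of fun i j : Fin 1 => if i.val + j.val + 1 = 1 then (1 : L) else 0)).Local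 v)))]
  [bH : ∀ a : ((cmDatum L 2 (Matrix.of fun i j : Fin 2 => if i.val + j.val + 1 = 2 then (1 : L) else 0)).Local v × (cmDatum L 1 (Matrix.of fun i j : Fin 1 => if i.val + j.val + 1 = 1 then (1 : L) else 0)).Local v), BorelSpace (((cmDatum L 2 (Matrix.of fun i j : Fin 2 => if i.val + j.val + 1 = 2 then (1 : L) else 0)).Local v × (cmDatum L 1 (Matrix.of fun i j : Fin 1 => if i.val + j.val + 1 = 1 then (1 : L) else 0)).Local v) ⧸ Subgroup.centralizer ({a} : Set ((cmDatum L 2 (Matrix.of fun i j : Fin 2 => if i.val + j.val + 1 = 2 then (1 : L) else 0)).Local v × (cmDatum L 1 (Matrix.of fun i j : Fin 1 => if i.val + j.val + 1 = 1 then (1 : L) else 0)).Local v)))]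

set_option maxHeartbeats 800000 in
/-- **Harish-Chandra descent at `ε_H = (a·1₂, u)` through the central dock `θ`, WITH THE VALUE OF THE DESCENDED FUNCTION AT THE CENTRE.**  ★ p842098's
binders verbatim + `hεO` (the orbit of `ε` is closed); for `ψ ∈ C_c^∞(G′_v)`: a stably saturated `B ∈ 𝓝 ε_H` and `ψ_ε ∈ C_c^∞(H_v)` with (i) for every Haar
inversion-invariant `νM = θ_* ν_H` on `Z(ε)`, `ψ_ε(ε_H) = O_ε(ψ; quotientMeasure Z(ε) νM ν_G)`, and (ii) `Φ(⟦θ h⟧, ψ; mG) = Φ(⟦h⟧, ψ_ε; mH)` for all `G`-regular `h ∈ B`.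
The proof is p842098's token for token with `ψ_ε := ψ_M ∘ θ` kept in hand; (i) is §1 at `γ := ε` with W2's compact `C` (read at `h = ε_H`).
[cite: Rogawski1990, §8.2 Prop. 8.2.1 (a) pp. 117–119; §4.3 (4.3.1) p. 43] [cite: HarishChandra1970, Part I §3 Lemmas 19–23] [cite: LanglandsShelstad1990Descent, §2.4]
[cite: DeitmarEchterhoff2014, Thm. 1.5.3] -/
theorem exists_nhds_classOrbitalIntegral_dock_eq_and_apply_centre
    (hH' : (H'.map (cmConjRingHom L))ᵀ = H') (hdet' : H'.det ≠ 0)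
    (w : PlacesOver L v) (hw : IsCMField.complexConj L • w.1 = w.1)
    (νH : Measure ((cmDatum L 2 (Matrix.of fun i j : Fin 2 => if i.val + j.val + 1 = 2 then (1 : L) else 0)).Local v × (cmDatum L 1 (Matrix.of fun i j : Fin 1 => if i.val + j.val + 1 = 1 then (1 : L) else 0)).Local v)) [νH.IsHaarMeasure] [νH.IsMulRightInvariant]
    (νG : Measure ((cmDatum L 3 H').Local v)) [νG.IsHaarMeasure] [νG.IsMulRightInvariant]
    {mH : OrbitalMeasureFamily ((cmDatum L 2 (Matrix.of fun i j : Fin 2 => if i.val + j.val + 1 = 2 then (1 : L) else 0)).Local v × (cmDatum L 1 (Matrix.of fun i j : Fin 1 => if i.val + j.val + 1 = 1 then (1 : L) else 0)).Local v)} {mG : OrbitalMeasureFamily ((cmDatum L 3 H').Local v)}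
    (hmH : mH.IsCanonical (IsLocalGRegular L v) νH)
    (hmG : mG.IsCanonical (fun γ => IsRegularElt (γ.val : GL (Fin 3) (LocalRing L v))) νG)
    (εH : ((cmDatum L 2 (Matrix.of fun i j : Fin 2 => if i.val + j.val + 1 = 2 then (1 : L) else 0)).Local v × (cmDatum L 1 (Matrix.of fun i j : Fin 1 => if i.val + j.val + 1 = 1 then (1 : L) else 0)).Local v)) (a : LocalRing L v)
    (ha : (εH.1.val.val : Matrix (Fin 2) (Fin 2) (LocalRing L v)) = a • (1 : Matrix (Fin 2) (Fin 2) (LocalRing L v)))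
    (hu : (εH.2.val.val : Matrix (Fin 1) (Fin 1) (LocalRing L v)) 0 0 ≠ a)
    (ε : ((cmDatum L 3 H').Local v)) (y : GL (Fin 3) (LocalRing L v)) (θ : ((cmDatum L 2 (Matrix.of fun i j : Fin 2 => if i.val + j.val + 1 = 2 then (1 : L) else 0)).Local v × (cmDatum L 1 (Matrix.of fun i j : Fin 1 => if i.val + j.val + 1 = 1 then (1 : L) else 0)).Local v) ≃ₜ* ↥(Subgroup.centralizer ({ε} : Set ((cmDatum L 3 H').Local v)))) (hθε : (θ εH).1 = ε)
    (hθ : ∀ z : ((cmDatum L 2 (Matrix.of fun i j : Fin 2 => if i.val + j.val + 1 = 2 then (1 : L) else 0)).Local v × (cmDatum L 1 (Matrix.of fun i j : Fin 1 => if i.val + j.val + 1 = 1 then (1 : L) else 0)).Local v), (((θ z).1).val : GL (Fin 3) (LocalRing L v)) = y * ((endoEmbLocal L v z).val : GL (Fin 3) (LocalRing L v)) * y⁻¹)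
    (hεO : IsClosed {g : ((cmDatum L 3 H').Local v) | ∃ x : ((cmDatum L 3 H').Local v), x * ε * x⁻¹ = g})
    (ψ : ((cmDatum L 3 H').Local v) → ℂ) (hψ : IsLocSmooth ψ) :
    ∃ B ∈ 𝓝 εH, (∀ h ∈ B, ∀ h' : ((cmDatum L 2 (Matrix.of fun i j : Fin 2 => if i.val + j.val + 1 = 2 then (1 : L) else 0)).Local v × (cmDatum L 1 (Matrix.of fun i j : Fin 1 => if i.val + j.val + 1 = 1 then (1 : L) else 0)).Local v), IsLocalStablyConjH L v h h' → h' ∈ B) ∧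
      ∃ ψε : ((cmDatum L 2 (Matrix.of fun i j : Fin 2 => if i.val + j.val + 1 = 2 then (1 : L) else 0)).Local v × (cmDatum L 1 (Matrix.of fun i j : Fin 1 => if i.val + j.val + 1 = 1 then (1 : L) else 0)).Local v) → ℂ, IsLocSmooth ψε ∧
        (∀ (νM : Measure ↥(Subgroup.centralizer ({ε} : Set ((cmDatum L 3 H').Local v)))) [νM.IsHaarMeasure] [νM.IsInvInvariant], νM = Measure.map (⇑θ) νH →
          ψε εH = orbitalIntegral ε ψ (quotientMeasure (Subgroup.centralizer ({ε} : Set ((cmDatum L 3 H').Local v))) νM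
            (isClosed_coe_centralizer_singleton ε) νG)) ∧
        ∀ h ∈ B, IsLocalGRegular L v h →
          classOrbitalIntegral mG ψ (ConjClasses.mk ((θ h : ↥(Subgroup.centralizer ({ε} : Set ((cmDatum L 3 H').Local v)))) : ((cmDatum L 3 H').Local v))) = classOrbitalIntegral mH ψε (ConjClasses.mk h) := by
  classical
  -- (0) the test function
  have hψlc : IsLocallyConstant ψ := ((isLocSmooth_iff ψ).1 hψ).1
  have hψs : HasCompactSupport ψ := ((isLocSmooth_iff ψ).1 hψ).2
  have hψc : Continuous ψ := hψlc.continuous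
  -- (1) ★ W2: the stably saturated window `B` and, for `Ω := tsupport ψ`, the compact `C`
  obtain ⟨B, hB, hBsat, hBC⟩ :=
    exists_nhds_stablySaturated_conj_mem_imp_mem_mul_centralizer L H' hH' hdet' w hw εH a ha hu ε y θ hθε hθ
  obtain ⟨C, hCc, hC⟩ := hBC (tsupport ψ) hψs
  -- (2) `M := Z(ε)` closed, locally compact; `θ` as a bare group isomorphism `e`; `νM := e_* νH`
  have hMc : IsClosed (((Subgroup.centralizer ({ε} : Set ((cmDatum L 3 H').Local v))) : Subgroup ((cmDatum L 3 H').Local v)) : Set ((cmDatum L 3 H').Local v)) := isClosed_coe_centralizer_singleton ε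
  haveI : LocallyCompactSpace ↥(Subgroup.centralizer ({ε} : Set ((cmDatum L 3 H').Local v))) := hMc.isClosedEmbedding_subtypeVal.locallyCompactSpace
  obtain ⟨e, he, hes, heθ⟩ : ∃ e : ((cmDatum L 2 (Matrix.of fun i j : Fin 2 => if i.val + j.val + 1 = 2 then (1 : L) else 0)).Local v × (cmDatum L 1 (Matrix.of fun i j : Fin 1 => if i.val + j.val + 1 = 1 then (1 : L) else 0)).Local v) ≃* ↥(Subgroup.centralizer ({ε} : Set ((cmDatum L 3 H').Local v))), Continuous e ∧ Continuous e.symm ∧ ∀ z, e z = θ z :=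
    ⟨θ.toMulEquiv, θ.continuous, θ.symm.continuous, fun _ => rfl⟩
  haveI hνM1 : (Measure.map e νH).IsHaarMeasure := MulEquiv.isHaarMeasure_map νH e he hes
  haveI hνM2 : (Measure.map e νH).IsMulRightInvariant := isMulRightInvariant_map_mulEquiv_of_isMulRightInvariant e he.measurable νH
  haveI hνM3 : (Measure.map e νH).IsInvInvariant := isInvInvariant_of_isMulRightInvariant_of_isClosed (Subgroup.centralizer ({ε} : Set ((cmDatum L 3 H').Local v))) hMc (Measure.map e νH)
  -- (3) ★ M1: Harish-Chandra's cut-off `β` for `(C, M, νM)`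
  obtain ⟨β, hβc, hβs, hβ0, hβ1⟩ := exists_continuous_hasCompactSupport_integral_comp_mul_eq_one (Subgroup.centralizer ({ε} : Set ((cmDatum L 3 H').Local v))) hMc (Measure.map e νH) hCc
  -- (4) ★ M2a: `ψ_M` is locally constant with compact support; `ψ_ε := ψ_M ∘ θ`
  have hlcM : IsLocallyConstant (fun m : ↥(Subgroup.centralizer ({ε} : Set ((cmDatum L 3 H').Local v))) => ∫ x, β x • ψ (x * (m : ((cmDatum L 3 H').Local v)) * x⁻¹) ∂νG) := isLocallyConstant_integral_conj νG (Subgroup.centralizer ({ε} : Set ((cmDatum L 3 H').Local v))) hβs hψlc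
  have hcsM : HasCompactSupport (fun m : ↥(Subgroup.centralizer ({ε} : Set ((cmDatum L 3 H').Local v))) => ∫ x, β x • ψ (x * (m : ((cmDatum L 3 H').Local v)) * x⁻¹) ∂νG) := hasCompactSupport_integral_conj νG (Subgroup.centralizer ({ε} : Set ((cmDatum L 3 H').Local v))) hMc hβs hψs
  refine ⟨B, hB, hBsat, (fun z : ((cmDatum L 2 (Matrix.of fun i j : Fin 2 => if i.val + j.val + 1 = 2 then (1 : L) else 0)).Local v × (cmDatum L 1 (Matrix.of fun i j : Fin 1 => if i.val + j.val + 1 = 1 then (1 : L) else 0)).Local v) => ∫ x, β x • ψ (x * ((θ z : ↥(Subgroup.centralizer ({ε} : Set ((cmDatum L 3 H').Local v)))) : ((cmDatum L 3 H').Local v)) * x⁻¹) ∂νG), ?_, ?_, ?_⟩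
  · exact (isLocSmooth_iff _).2 ⟨hlcM.comp_continuous θ.continuous, hcsM.comp_homeomorph θ.toHomeomorph⟩
  · -- THE VALUE AT THE CENTRE: `ψ_ε(ε_H) = ψ_M(θ ε_H) = ψ_M(ε) = ∫_G β(x) ψ(x ε x⁻¹) dν_G = O_ε(ψ; ν_G ∕ θ_*ν_H)` (the cut-off is normalised along `Z(ε)`)
    intro νM _ _ hνM
    subst hνM
    have hee : (⇑e : _ → ↥(Subgroup.centralizer ({ε} : Set ((cmDatum L 3 H').Local v)))) = ⇑θ := funext heθ
    change (∫ x, β x • ψ (x * ((θ εH : ↥(Subgroup.centralizer ({ε} : Set ((cmDatum L 3 H').Local v)))) : ((cmDatum L 3 H').Local v)) * x⁻¹) ∂νG) = _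
    rw [hθε]
    have hβ1' : ∀ c ∈ C, ∀ k₀ : ↥(Subgroup.centralizer ({ε} : Set ((cmDatum L 3 H').Local v))), ∫ h : ↥(Subgroup.centralizer ({ε} : Set ((cmDatum L 3 H').Local v))), β (c * (k₀ : ((cmDatum L 3 H').Local v)) * (h : ((cmDatum L 3 H').Local v))) ∂(Measure.map (⇑θ) νH) = 1 := by
      rw [← hee]; exact hβ1
    have hCM : ∀ x : ((cmDatum L 3 H').Local v), x * ε * x⁻¹ ∈ tsupport ψ →
        x ∈ C * (((Subgroup.centralizer ({ε} : Set ((cmDatum L 3 H').Local v))) : Subgroup ((cmDatum L 3 H').Local v)) : Set ((cmDatum L 3 H').Local v)) :=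
      fun x hx => hC x εH (mem_of_mem_nhds hB) (by rw [hθε]; exact hx)
    exact integral_smul_conj_eq_orbitalIntegral_of_cutoff ε hεO (Measure.map (⇑θ) νH) νG hβc hβs hβ1' hψc hψs hCM
  -- (5) the identity at a `G`-regular `h ∈ B`, run at the representative `γ_H := out ⟦h⟧`
  intro h hh hreg
  have hoq : ConjClasses.mk (Quotient.out (ConjClasses.mk h)) = ConjClasses.mk h := Quotient.out_eq (ConjClasses.mk h)
  have hconj : IsConj (Quotient.out (ConjClasses.mk h)) h := ConjClasses.mk_eq_mk_iff_isConj.1 hoq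
  have hst : IsLocalStablyConjH L v h (Quotient.out (ConjClasses.mk h)) := isStablyConjH_of_isConj hconj.symm
  have hγHB : (Quotient.out (ConjClasses.mk h)) ∈ B := hBsat h hh (Quotient.out (ConjClasses.mk h)) hst
  have hregH : IsLocalGRegular L v (Quotient.out (ConjClasses.mk h)) := isGRegular_of_isStablyConjH _ _ _ _ hst hreg
  -- the canonical torus measure `t_H` at `⟦h⟧` on the `H`-side
  obtain ⟨tH, htH1, htH2, htHcore, hmHc⟩ := hmH (ConjClasses.mk h) hregH
  have hZHc : IsClosed (((Subgroup.centralizer ({(Quotient.out (ConjClasses.mk h))} : Set ((cmDatum L 2 (Matrix.of fun i j : Fin 2 => if i.val + j.val + 1 = 2 then (1 : L) else 0)).Local v × (cmDatum L 1 (Matrix.of fun i j : Fin 1 => if i.val + j.val + 1 = 1 then (1 : L) else 0)).Local v))) : Subgroup ((cmDatum L 2 (Matrix.of fun i j : Fin 2 => if i.val + j.val + 1 = 2 then (1 : L) else 0)).Local v × (cmDatum L 1 (Matrix.of fun i j : Fin 1 => if i.val + j.val + 1 = 1 then (1 : L) else 0)).Local v)) : Set ((cmDatum L 2 (Matrix.of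 fun i j : Fin 2 => if i.val + j.val + 1 = 2 then (1 : L) else 0)).Local v × (cmDatum L 1 (Matrix.of fun i j : Fin 1 => if i.val + j.val + 1 = 1 then (1 : L) else 0)).Local v)) := isClosed_coe_centralizer_singleton _
  haveI : LocallyCompactSpace ↥(Subgroup.centralizer ({(Quotient.out (ConjClasses.mk h))} : Set ((cmDatum L 2 (Matrix.of fun i j : Fin 2 => if i.val + j.val + 1 = 2 then (1 : L) else 0)).Local v × (cmDatum L 1 (Matrix.of fun i j : Fin 1 => if i.val + j.val + 1 = 1 then (1 : L) else 0)).Local v))) := hZHc.isClosedEmbedding_subtypeVal.locallyCompactSpace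
  -- (c4) `γ″ := θ γ_H` is regular in `GL₃`
  have hregG : IsRegularElt ((((e (Quotient.out (ConjClasses.mk h)) : ↥(Subgroup.centralizer ({ε} : Set ((cmDatum L 3 H').Local v)))) : ((cmDatum L 3 H').Local v))).val : GL (Fin 3) (LocalRing L v)) := by
    rw [heθ, hθ (Quotient.out (ConjClasses.mk h)), isRegularElt_conj_iff]
    exact hregH
  -- (c1) the centraliser `T := Z_{G′}(γ″)`: commutative and contained in `M`
  have hcommM := commute_of_commute_of_isRegularElt_local L v ((e (Quotient.out (ConjClasses.mk h)) : ↥(Subgroup.centralizer ({ε} : Set ((cmDatum L 3 H').Local v)))) : ((cmDatum L 3 H').Local v)) hregG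
  have hval : ∀ s s' : ((cmDatum L 3 H').Local v), s * s' = s' * s ↔ Commute ((s.val : GL (Fin 3) (LocalRing L v)).val) ((s'.val : GL (Fin 3) (LocalRing L v)).val) := by
    intro s s'
    constructor
    · intro hss'
      exact congrArg (fun g : ((cmDatum L 3 H').Local v) => ((g.val : GL (Fin 3) (LocalRing L v)).val)) hss'
    · intro hc
      exact Subtype.ext (Units.ext hc)
  have hεc : Commute ((ε.val : GL (Fin 3) (LocalRing L v)).val) (((((e (Quotient.out (ConjClasses.mk h)) : ↥(Subgroup.centralizer ({ε} : Set ((cmDatum L 3 H').Local v)))) : ((cmDatum L 3 H').Local v))).val : GL (Fin 3) (LocalRing L v)).val) :=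
    ((hval _ _).1 (Subgroup.mem_centralizer_singleton_iff.1 (e (Quotient.out (ConjClasses.mk h))).2)).symm
  have hTM : ∀ s ∈ (Subgroup.centralizer ({((e (Quotient.out (ConjClasses.mk h)) : ↥(Subgroup.centralizer ({ε} : Set ((cmDatum L 3 H').Local v)))) : ((cmDatum L 3 H').Local v))} : Set ((cmDatum L 3 H').Local v))), s ∈ (Subgroup.centralizer ({ε} : Set ((cmDatum L 3 H').Local v))) := fun s hs =>
    Subgroup.mem_centralizer_singleton_iff.2 ((hval _ _).2
      (hcommM _ _ ((hval _ _).1 (Subgroup.mem_centralizer_singleton_iff.1 hs)) hεc))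
  have hTcomm : ∀ s ∈ (Subgroup.centralizer ({((e (Quotient.out (ConjClasses.mk h)) : ↥(Subgroup.centralizer ({ε} : Set ((cmDatum L 3 H').Local v)))) : ((cmDatum L 3 H').Local v))} : Set ((cmDatum L 3 H').Local v))), ∀ s' ∈ (Subgroup.centralizer ({((e (Quotient.out (ConjClasses.mk h)) : ↥(Subgroup.centralizer ({ε} : Set ((cmDatum L 3 H').Local v)))) : ((cmDatum L 3 H').Local v))} : Set ((cmDatum L 3 H').Local v))), s * s' = s' * s := fun s hs s' hs' =>
    (hval _ _).2 (hcommM _ _ ((hval _ _).1 (Subgroup.mem_centralizer_singleton_iff.1 hs))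
      ((hval _ _).1 (Subgroup.mem_centralizer_singleton_iff.1 hs')))
  have hTc : IsClosed (((Subgroup.centralizer ({((e (Quotient.out (ConjClasses.mk h)) : ↥(Subgroup.centralizer ({ε} : Set ((cmDatum L 3 H').Local v)))) : ((cmDatum L 3 H').Local v))} : Set ((cmDatum L 3 H').Local v))) : Subgroup ((cmDatum L 3 H').Local v)) : Set ((cmDatum L 3 H').Local v)) := isClosed_coe_centralizer_singleton _
  have hTMc : IsClosed (((Subgroup.centralizer ({e (Quotient.out (ConjClasses.mk h))} : Set ↥(Subgroup.centralizer ({ε} : Set ((cmDatum L 3 H').Local v))))) : Subgroup ↥(Subgroup.centralizer ({ε} : Set ((cmDatum L 3 H').Local v)))) : Set ↥(Subgroup.centralizer ({ε} : Set ((cmDatum L 3 H').Local v)))) := isClosed_coe_centralizer_singleton _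
  haveI : LocallyCompactSpace ↥(Subgroup.centralizer ({e (Quotient.out (ConjClasses.mk h))} : Set ↥(Subgroup.centralizer ({ε} : Set ((cmDatum L 3 H').Local v))))) := hTMc.isClosedEmbedding_subtypeVal.locallyCompactSpace
  -- `incl : Z_M(γ″) ≃ₜ* T`
  have hmemT : ∀ s : ↥(Subgroup.centralizer ({e (Quotient.out (ConjClasses.mk h))} : Set ↥(Subgroup.centralizer ({ε} : Set ((cmDatum L 3 H').Local v))))), ((s : ↥(Subgroup.centralizer ({ε} : Set ((cmDatum L 3 H').Local v)))) : ((cmDatum L 3 H').Local v)) ∈ (Subgroup.centralizer ({((e (Quotient.out (ConjClasses.mk h)) : ↥(Subgroup.centralizer ({ε} : Set ((cmDatum L 3 H').Local v)))) : ((cmDatum L 3 H').Local v))} : Set ((cmDatum L 3 H').Local v))) := fun s =>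
    Subgroup.mem_centralizer_singleton_iff.2 (by
      have h1 := Subgroup.mem_centralizer_singleton_iff.1 s.2
      exact_mod_cast congrArg ((↑) : ↥(Subgroup.centralizer ({ε} : Set ((cmDatum L 3 H').Local v))) → ((cmDatum L 3 H').Local v)) h1)
  have hmemTM : ∀ s : ↥(Subgroup.centralizer ({((e (Quotient.out (ConjClasses.mk h)) : ↥(Subgroup.centralizer ({ε} : Set ((cmDatum L 3 H').Local v)))) : ((cmDatum L 3 H').Local v))} : Set ((cmDatum L 3 H').Local v))), (⟨(s : ((cmDatum L 3 H').Local v)), hTM s s.2⟩ : ↥(Subgroup.centralizer ({ε} : Set ((cmDatum L 3 H').Local v)))) ∈ (Subgroup.centralizer ({e (Quotient.out (ConjClasses.mk h))} : Set ↥(Subgroup.centralizer ({ε} : Set ((cmDatum L 3 H').Local v))))) := fun s =>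
    Subgroup.mem_centralizer_singleton_iff.2 (Subtype.ext (by
      have h1 := Subgroup.mem_centralizer_singleton_iff.1 s.2
      simpa only [Subgroup.coe_mul] using h1))
  let eT : ↥(Subgroup.centralizer ({e (Quotient.out (ConjClasses.mk h))} : Set ↥(Subgroup.centralizer ({ε} : Set ((cmDatum L 3 H').Local v))))) ≃ₜ* ↥(Subgroup.centralizer ({((e (Quotient.out (ConjClasses.mk h)) : ↥(Subgroup.centralizer ({ε} : Set ((cmDatum L 3 H').Local v)))) : ((cmDatum L 3 H').Local v))} : Set ((cmDatum L 3 H').Local v))) :=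
    { toFun := fun s => ⟨((s : ↥(Subgroup.centralizer ({ε} : Set ((cmDatum L 3 H').Local v)))) : ((cmDatum L 3 H').Local v)), hmemT s⟩
      invFun := fun s => ⟨⟨(s : ((cmDatum L 3 H').Local v)), hTM s s.2⟩, hmemTM s⟩
      left_inv := fun s => rfl
      right_inv := fun s => rfl
      map_mul' := fun s s' => rfl
      continuous_toFun := (continuous_subtype_val.comp continuous_subtype_val).subtype_mk _
      continuous_invFun := ((continuous_subtype_val).subtype_mk _).subtype_mk _ }
  -- the torus measures: `t_M := (θ|)_* t_H` on `Z_M(γ″)`, `t := incl_* t_M` on `T`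
  have hHH' : ∀ g : ((cmDatum L 2 (Matrix.of fun i j : Fin 2 => if i.val + j.val + 1 = 2 then (1 : L) else 0)).Local v × (cmDatum L 1 (Matrix.of fun i j : Fin 1 => if i.val + j.val + 1 = 1 then (1 : L) else 0)).Local v), e g ∈ (Subgroup.centralizer ({e (Quotient.out (ConjClasses.mk h))} : Set ↥(Subgroup.centralizer ({ε} : Set ((cmDatum L 3 H').Local v))))) ↔ g ∈ (Subgroup.centralizer ({(Quotient.out (ConjClasses.mk h))} : Set ((cmDatum L 2 (Matrix.of fun i j : Fin 2 => if i.val + j.val + 1 = 2 then (1 : L) else 0)).Local v × (cmDatum L 1 (Matrix.of fun i j : Fin 1 => if i.val + j.val + 1 = 1 then (1 : L) else 0)).Local v))) := fun g => by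
    rw [Subgroup.mem_centralizer_singleton_iff, Subgroup.mem_centralizer_singleton_iff, ← map_mul, ← map_mul, e.apply_eq_iff_eq]
  haveI htM1 : (Measure.map (subgroupCongrHomeomorph e (Subgroup.centralizer ({(Quotient.out (ConjClasses.mk h))} : Set ((cmDatum L 2 (Matrix.of fun i j : Fin 2 => if i.val + j.val + 1 = 2 then (1 : L) else 0)).Local v × (cmDatum L 1 (Matrix.of fun i j : Fin 1 => if i.val + j.val + 1 = 1 then (1 : L) else 0)).Local v))) (Subgroup.centralizer ({e (Quotient.out (ConjClasses.mk h))} : Set ↥(Subgroup.centralizer ({ε} : Set ((cmDatum L 3 H').Local v))))) hHH' he hes) tH).IsHaarMeasure :=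
    isHaarMeasure_map_subgroupCongrHomeomorph e he hes (Subgroup.centralizer ({(Quotient.out (ConjClasses.mk h))} : Set ((cmDatum L 2 (Matrix.of fun i j : Fin 2 => if i.val + j.val + 1 = 2 then (1 : L) else 0)).Local v × (cmDatum L 1 (Matrix.of fun i j : Fin 1 => if i.val + j.val + 1 = 1 then (1 : L) else 0)).Local v))) (Subgroup.centralizer ({e (Quotient.out (ConjClasses.mk h))} : Set ↥(Subgroup.centralizer ({ε} : Set ((cmDatum L 3 H').Local v))))) hHH' tH
  haveI htM2 : (Measure.map (subgroupCongrHomeomorph e (Subgroup.centralizer ({(Quotient.out (ConjClasses.mk h))} : Set ((cmDatum L 2 (Matrix.of fun i j : Fin 2 => if i.val + j.val + 1 = 2 then (1 : L) else 0)).Local v × (cmDatum L 1 (Matrix.of fun i j : Fin 1 => if i.val + j.val + 1 = 1 then (1 : L) else 0)).Local v))) (Subgroup.centralizer ({e (Quotient.out (ConjClasses.mk h))} : Set ↥(Subgroup.centralizer ({ε} : Set ((cmDatum L 3 H').Local v))))) hHH' he hes) tH).IsInvInvariant :=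
    isInvInvariant_map_subgroupCongrHomeomorph e he hes (Subgroup.centralizer ({(Quotient.out (ConjClasses.mk h))} : Set ((cmDatum L 2 (Matrix.of fun i j : Fin 2 => if i.val + j.val + 1 = 2 then (1 : L) else 0)).Local v × (cmDatum L 1 (Matrix.of fun i j : Fin 1 => if i.val + j.val + 1 = 1 then (1 : L) else 0)).Local v))) (Subgroup.centralizer ({e (Quotient.out (ConjClasses.mk h))} : Set ↥(Subgroup.centralizer ({ε} : Set ((cmDatum L 3 H').Local v))))) hHH' tH
  haveI htT1 : (Measure.map eT (Measure.map (subgroupCongrHomeomorph e (Subgroup.centralizer ({(Quotient.out (ConjClasses.mk h))} : Set ((cmDatum L 2 (Matrix.of fun i j : Fin 2 => if i.val + j.val + 1 = 2 then (1 : L) else 0)).Local v × (cmDatum L 1 (Matrix.of fun i j : Fin 1 => if i.val + j.val + 1 = 1 then (1 : L) else 0)).Local v))) (Subgroup.centralizer ({e (Quotient.out (ConjClasses.mk h))} : Set ↥(Subgroup.centralizer ({ε} : Set ((cmDatum L 3 H').Local v))))) hHH' he hes) tH)).IsHaarMeasure :=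
    MulEquiv.isHaarMeasure_map _ eT.toMulEquiv eT.continuous eT.symm.continuous
  haveI htT2 : (Measure.map eT (Measure.map (subgroupCongrHomeomorph e (Subgroup.centralizer ({(Quotient.out (ConjClasses.mk h))} : Set ((cmDatum L 2 (Matrix.of fun i j : Fin 2 => if i.val + j.val + 1 = 2 then (1 : L) else 0)).Local v × (cmDatum L 1 (Matrix.of fun i j : Fin 1 => if i.val + j.val + 1 = 1 then (1 : L) else 0)).Local v))) (Subgroup.centralizer ({e (Quotient.out (ConjClasses.mk h))} : Set ↥(Subgroup.centralizer ({ε} : Set ((cmDatum L 3 H').Local v))))) hHH' he hes) tH)).IsInvInvariant :=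
    isInvInvariant_map_mulEquiv eT.toMulEquiv eT.continuous.measurable _
  haveI htT3 : (Measure.map eT (Measure.map (subgroupCongrHomeomorph e (Subgroup.centralizer ({(Quotient.out (ConjClasses.mk h))} : Set ((cmDatum L 2 (Matrix.of fun i j : Fin 2 => if i.val + j.val + 1 = 2 then (1 : L) else 0)).Local v × (cmDatum L 1 (Matrix.of fun i j : Fin 1 => if i.val + j.val + 1 = 1 then (1 : L) else 0)).Local v))) (Subgroup.centralizer ({e (Quotient.out (ConjClasses.mk h))} : Set ↥(Subgroup.centralizer ({ε} : Set ((cmDatum L 3 H').Local v))))) hHH' he hes) tH)).IsMulRightInvariant :=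
    isMulRightInvariant_of_forall_comm (Subgroup.centralizer ({((e (Quotient.out (ConjClasses.mk h)) : ↥(Subgroup.centralizer ({ε} : Set ((cmDatum L 3 H').Local v)))) : ((cmDatum L 3 H').Local v))} : Set ((cmDatum L 3 H').Local v))) hTc hTcomm _
  -- normalisation: `t (compactCore T) = 1`
  have hcoreM : (Measure.map (subgroupCongrHomeomorph e (Subgroup.centralizer ({(Quotient.out (ConjClasses.mk h))} : Set ((cmDatum L 2 (Matrix.of fun i j : Fin 2 => if i.val + j.val + 1 = 2 then (1 : L) else 0)).Local v × (cmDatum L 1 (Matrix.of fun i j : Fin 1 => if i.val + j.val + 1 = 1 then (1 : L) else 0)).Local v))) (Subgroup.centralizer ({e (Quotient.out (ConjClasses.mk h))} : Set ↥(Subgroup.centralizer ({ε} : Set ((cmDatum L 3 H').Local v))))) hHH' he hes) tH) (compactCore ↥(Subgroup.centralizer ({e (Quotient.out (ConjClasses.mk h))} : Set ↥(Subgroup.centralizer ({ε} : Set ((cmDatum L 3 H').Local v)))))) = 1 := by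
    let eM : ↥(Subgroup.centralizer ({(Quotient.out (ConjClasses.mk h))} : Set ((cmDatum L 2 (Matrix.of fun i j : Fin 2 => if i.val + j.val + 1 = 2 then (1 : L) else 0)).Local v × (cmDatum L 1 (Matrix.of fun i j : Fin 1 => if i.val + j.val + 1 = 1 then (1 : L) else 0)).Local v))) ≃ₜ* ↥(Subgroup.centralizer ({e (Quotient.out (ConjClasses.mk h))} : Set ↥(Subgroup.centralizer ({ε} : Set ((cmDatum L 3 H').Local v))))) :=
      { (subgroupCongrHomeomorph e (Subgroup.centralizer ({(Quotient.out (ConjClasses.mk h))} : Set ((cmDatum L 2 (Matrix.of fun i j : Fin 2 => if i.val + j.val + 1 = 2 then (1 : L) else 0)).Local v × (cmDatum L 1 (Matrix.of fun i j : Fin 1 => if i.val + j.val + 1 = 1 then (1 : L) else 0)).Local v))) (Subgroup.centralizer ({e (Quotient.out (ConjClasses.mk h))} : Set ↥(Subgroup.centralizer ({ε} : Set ((cmDatum L 3 H').Local v))))) hHH' he hes).toEquiv with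
        map_mul' := fun s s' => Subtype.ext (by
          change e ((s * s' : ↥(Subgroup.centralizer ({(Quotient.out (ConjClasses.mk h))} : Set ((cmDatum L 2 (Matrix.of fun i j : Fin 2 => if i.val + j.val + 1 = 2 then (1 : L) else 0)).Local v × (cmDatum L 1 (Matrix.of fun i j : Fin 1 => if i.val + j.val + 1 = 1 then (1 : L) else 0)).Local v)))) : ((cmDatum L 2 (Matrix.of fun i j : Fin 2 => if i.val + j.val + 1 = 2 then (1 : L) else 0)).Local v × (cmDatum L 1 (Matrix.of fun i j : Fin 1 => if i.val + j.val + 1 = 1 then (1 : L) else 0)).Local v)) = e (s : ((cmDatum L 2 (Matrix.of fun i j : Fin 2 => if i.val + j.val + 1 = 2 then (1 : L) else 0)).Local v × (cmDatum L 1 (Matrix.of fun i j : Fin 1 => if i.val + j.val + 1 = 1 then (1 : L) else 0)).Local v)) * e (s' : ((cmDatum L 2 (Matrix.of fun i j : Fin 2 => if i.val + j.val + 1 = 2 then (1 : L) else 0)).Local v × (cmDatum L 1 (Matrix.of fun i j : Fin 1 => if i.val + j.val + 1 = 1 then (1 : L) else 0)).Local v))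
          rw [Subgroup.coe_mul, map_mul])
        continuous_toFun := (subgroupCongrHomeomorph e (Subgroup.centralizer ({(Quotient.out (ConjClasses.mk h))} : Set ((cmDatum L 2 (Matrix.of fun i j : Fin 2 => if i.val + j.val + 1 = 2 then (1 : L) else 0)).Local v × (cmDatum L 1 (Matrix.of fun i j : Fin 1 => if i.val + j.val + 1 = 1 then (1 : L) else 0)).Local v))) (Subgroup.centralizer ({e (Quotient.out (ConjClasses.mk h))} : Set ↥(Subgroup.centralizer ({ε} : Set ((cmDatum L 3 H').Local v))))) hHH' he hes).continuous
        continuous_invFun := (subgroupCongrHomeomorph e (Subgroup.centralizer ({(Quotient.out (ConjClasses.mk h))} : Set ((cmDatum L 2 (Matrix.of fun i j : Fin 2 => if i.val + j.val + 1 = 2 then (1 : L) else 0)).Local v × (cmDatum L 1 (Matrix.of fun i j : Fin 1 => if i.val + j.val + 1 = 1 then (1 : L) else 0)).Local v))) (Subgroup.centralizer ({e (Quotient.out (ConjClasses.mk h))} : Set ↥(Subgroup.centralizer ({ε} : Set ((cmDatum L 3 H').Local v))))) hHH' he hes).symm.continuous }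
    have hco : ⇑eM = ⇑(subgroupCongrHomeomorph e (Subgroup.centralizer ({(Quotient.out (ConjClasses.mk h))} : Set ((cmDatum L 2 (Matrix.of fun i j : Fin 2 => if i.val + j.val + 1 = 2 then (1 : L) else 0)).Local v × (cmDatum L 1 (Matrix.of fun i j : Fin 1 => if i.val + j.val + 1 = 1 then (1 : L) else 0)).Local v))) (Subgroup.centralizer ({e (Quotient.out (ConjClasses.mk h))} : Set ↥(Subgroup.centralizer ({ε} : Set ((cmDatum L 3 H').Local v))))) hHH' he hes) := rfl
    rw [← Homeomorph.toMeasurableEquiv_coe, MeasurableEquiv.map_apply, Homeomorph.toMeasurableEquiv_coe, ← hco,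
      ← image_compactCore eM, eM.injective.preimage_image, htHcore]
  have hcoreT : (Measure.map eT (Measure.map (subgroupCongrHomeomorph e (Subgroup.centralizer ({(Quotient.out (ConjClasses.mk h))} : Set ((cmDatum L 2 (Matrix.of fun i j : Fin 2 => if i.val + j.val + 1 = 2 then (1 : L) else 0)).Local v × (cmDatum L 1 (Matrix.of fun i j : Fin 1 => if i.val + j.val + 1 = 1 then (1 : L) else 0)).Local v))) (Subgroup.centralizer ({e (Quotient.out (ConjClasses.mk h))} : Set ↥(Subgroup.centralizer ({ε} : Set ((cmDatum L 3 H').Local v))))) hHH' he hes) tH)) (compactCore ↥(Subgroup.centralizer ({((e (Quotient.out (ConjClasses.mk h)) : ↥(Subgroup.centralizer ({ε} : Set ((cmDatum L 3 H').Local v)))) : ((cmDatum L 3 H').Local v))} : Set ((cmDatum L 3 H').Local v)))) = 1 := by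
    have hco : ⇑eT = ⇑eT.toHomeomorph.toMeasurableEquiv := rfl
    rw [hco, MeasurableEquiv.map_apply, ← hco, ← image_compactCore eT, eT.injective.preimage_image, hcoreM]
  -- Borel structure on `M ⧸ Z_M(γ″)`
  letI iq : MeasurableSpace (↥(Subgroup.centralizer ({ε} : Set ((cmDatum L 3 H').Local v))) ⧸ (Subgroup.centralizer ({e (Quotient.out (ConjClasses.mk h))} : Set ↥(Subgroup.centralizer ({ε} : Set ((cmDatum L 3 H').Local v)))))) := borel _
  haveI : BorelSpace (↥(Subgroup.centralizer ({ε} : Set ((cmDatum L 3 H').Local v))) ⧸ (Subgroup.centralizer ({e (Quotient.out (ConjClasses.mk h))} : Set ↥(Subgroup.centralizer ({ε} : Set ((cmDatum L 3 H').Local v)))))) := ⟨rfl⟩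
  -- STEP A: same class
  have hA : ConjClasses.mk ((θ h : ↥(Subgroup.centralizer ({ε} : Set ((cmDatum L 3 H').Local v)))) : ((cmDatum L 3 H').Local v)) = ConjClasses.mk ((e (Quotient.out (ConjClasses.mk h)) : ↥(Subgroup.centralizer ({ε} : Set ((cmDatum L 3 H').Local v)))) : ((cmDatum L 3 H').Local v)) := by
    rw [heθ]
    obtain ⟨c, hc⟩ := isConj_iff.1 hconj.symm
    refine ConjClasses.mk_eq_mk_iff_isConj.2 (isConj_iff.2 ⟨((θ c : ↥(Subgroup.centralizer ({ε} : Set ((cmDatum L 3 H').Local v)))) : ((cmDatum L 3 H').Local v)), ?_⟩)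
    rw [← hc, map_mul, map_mul, map_inv, Subgroup.coe_mul, Subgroup.coe_mul, Subgroup.coe_inv]
  -- STEP B: the canonical member at `⟦γ″⟧` is `νG ∕ t` (★ `classOrbitalIntegral_mk_eq_orbitalIntegral'`)
  have hPG : ∀ g x : ((cmDatum L 3 H').Local v), IsRegularElt (g.val : GL (Fin 3) (LocalRing L v)) → IsRegularElt ((x * g * x⁻¹).val : GL (Fin 3) (LocalRing L v)) := fun g x hg =>
    (isRegularElt_conj_iff (x.val : GL (Fin 3) (LocalRing L v)) (g.val : GL (Fin 3) (LocalRing L v))).2 hg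
  have hB' := hmG.classOrbitalIntegral_mk_eq_orbitalIntegral' hPG hregG
    (Measure.map eT (Measure.map (subgroupCongrHomeomorph e (Subgroup.centralizer ({(Quotient.out (ConjClasses.mk h))} : Set ((cmDatum L 2 (Matrix.of fun i j : Fin 2 => if i.val + j.val + 1 = 2 then (1 : L) else 0)).Local v × (cmDatum L 1 (Matrix.of fun i j : Fin 1 => if i.val + j.val + 1 = 1 then (1 : L) else 0)).Local v))) (Subgroup.centralizer ({e (Quotient.out (ConjClasses.mk h))} : Set ↥(Subgroup.centralizer ({ε} : Set ((cmDatum L 3 H').Local v))))) hHH' he hes) tH)) hcoreT ψ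
  -- STEP C: ★ M3 — descent from `G′_v` to `M = Z(ε)` at `γ″`
  have hO : IsClosed {g : ((cmDatum L 3 H').Local v) | ∃ x : ((cmDatum L 3 H').Local v), x * ((e (Quotient.out (ConjClasses.mk h)) : ↥(Subgroup.centralizer ({ε} : Set ((cmDatum L 3 H').Local v)))) : ((cmDatum L 3 H').Local v)) * x⁻¹ = g} :=
    isClosed_conjClass_local_of_isRegularElt L 3 H' v hH' hdet' ((e (Quotient.out (ConjClasses.mk h)) : ↥(Subgroup.centralizer ({ε} : Set ((cmDatum L 3 H').Local v)))) : ((cmDatum L 3 H').Local v)) hregG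
  have hCM : ∀ x : ((cmDatum L 3 H').Local v), x * ((e (Quotient.out (ConjClasses.mk h)) : ↥(Subgroup.centralizer ({ε} : Set ((cmDatum L 3 H').Local v)))) : ((cmDatum L 3 H').Local v)) * x⁻¹ ∈ tsupport ψ → x ∈ C * (((Subgroup.centralizer ({ε} : Set ((cmDatum L 3 H').Local v))) : Subgroup ((cmDatum L 3 H').Local v)) : Set ((cmDatum L 3 H').Local v)) := fun x hx =>
    hC x (Quotient.out (ConjClasses.mk h)) hγHB (by rwa [heθ] at hx)
  have hC' := orbitalIntegral_eq_orbitalIntegral_descended νG (Subgroup.centralizer ({ε} : Set ((cmDatum L 3 H').Local v))) hMc (Measure.map e νH) (e (Quotient.out (ConjClasses.mk h)))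
    (hT := hTc) (hT' := hTMc)
    (Measure.map eT (Measure.map (subgroupCongrHomeomorph e (Subgroup.centralizer ({(Quotient.out (ConjClasses.mk h))} : Set ((cmDatum L 2 (Matrix.of fun i j : Fin 2 => if i.val + j.val + 1 = 2 then (1 : L) else 0)).Local v × (cmDatum L 1 (Matrix.of fun i j : Fin 1 => if i.val + j.val + 1 = 1 then (1 : L) else 0)).Local v))) (Subgroup.centralizer ({e (Quotient.out (ConjClasses.mk h))} : Set ↥(Subgroup.centralizer ({ε} : Set ((cmDatum L 3 H').Local v))))) hHH' he hes) tH))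
    (Measure.map (subgroupCongrHomeomorph e (Subgroup.centralizer ({(Quotient.out (ConjClasses.mk h))} : Set ((cmDatum L 2 (Matrix.of fun i j : Fin 2 => if i.val + j.val + 1 = 2 then (1 : L) else 0)).Local v × (cmDatum L 1 (Matrix.of fun i j : Fin 1 => if i.val + j.val + 1 = 1 then (1 : L) else 0)).Local v))) (Subgroup.centralizer ({e (Quotient.out (ConjClasses.mk h))} : Set ↥(Subgroup.centralizer ({ε} : Set ((cmDatum L 3 H').Local v))))) hHH' he hes) tH) rfl hO hβc hβs hβ0 hβ1 hψc hψs hCM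
  -- STEP D: transport along `θ : H_v ≃ M` (★ `integral_descConj_quotientMeasure_eq_of_mulEquiv`)
  haveI : IsClosed (((Subgroup.centralizer ({(Quotient.out (ConjClasses.mk h))} : Set ((cmDatum L 2 (Matrix.of fun i j : Fin 2 => if i.val + j.val + 1 = 2 then (1 : L) else 0)).Local v × (cmDatum L 1 (Matrix.of fun i j : Fin 1 => if i.val + j.val + 1 = 1 then (1 : L) else 0)).Local v))) : Subgroup ((cmDatum L 2 (Matrix.of fun i j : Fin 2 => if i.val + j.val + 1 = 2 then (1 : L) else 0)).Local v × (cmDatum L 1 (Matrix.of fun i j : Fin 1 => if i.val + j.val + 1 = 1 then (1 : L) else 0)).Local v)) : Set ((cmDatum L 2 (Matrix.of fun i j : Fin 2 => if i.val + j.val + 1 = 2 then (1 : L) else 0)).Local v × (cmDatum L 1 (Matrix.of fun i j : Fin 1 => if i.val + j.val + 1 = 1 then (1 : L) else 0)).Local v)) := hZHc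
  haveI : IsClosed (((Subgroup.centralizer ({e (Quotient.out (ConjClasses.mk h))} : Set ↥(Subgroup.centralizer ({ε} : Set ((cmDatum L 3 H').Local v))))) : Subgroup ↥(Subgroup.centralizer ({ε} : Set ((cmDatum L 3 H').Local v)))) : Set ↥(Subgroup.centralizer ({ε} : Set ((cmDatum L 3 H').Local v)))) := hTMc
  have hD' := integral_descConj_quotientMeasure_eq_of_mulEquiv e he hes (Subgroup.centralizer ({(Quotient.out (ConjClasses.mk h))} : Set ((cmDatum L 2 (Matrix.of fun i j : Fin 2 => if i.val + j.val + 1 = 2 then (1 : L) else 0)).Local v × (cmDatum L 1 (Matrix.of fun i j : Fin 1 => if i.val + j.val + 1 = 1 then (1 : L) else 0)).Local v))) (Subgroup.centralizer ({e (Quotient.out (ConjClasses.mk h))} : Set ↥(Subgroup.centralizer ({ε} : Set ((cmDatum L 3 H').Local v))))) hHH'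
    tH (Measure.map (subgroupCongrHomeomorph e (Subgroup.centralizer ({(Quotient.out (ConjClasses.mk h))} : Set ((cmDatum L 2 (Matrix.of fun i j : Fin 2 => if i.val + j.val + 1 = 2 then (1 : L) else 0)).Local v × (cmDatum L 1 (Matrix.of fun i j : Fin 1 => if i.val + j.val + 1 = 1 then (1 : L) else 0)).Local v))) (Subgroup.centralizer ({e (Quotient.out (ConjClasses.mk h))} : Set ↥(Subgroup.centralizer ({ε} : Set ((cmDatum L 3 H').Local v))))) hHH' he hes) tH) νH (Measure.map e νH) rfl rfl
    (rfl : e (Quotient.out (ConjClasses.mk h)) = e (Quotient.out (ConjClasses.mk h))) (fun _ hg => Subgroup.mem_centralizer_singleton_iff.1 hg)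
    (fun _ hg => Subgroup.mem_centralizer_singleton_iff.1 hg) (fun m : ↥(Subgroup.centralizer ({ε} : Set ((cmDatum L 3 H').Local v))) => ∫ x, β x • ψ (x * (m : ((cmDatum L 3 H').Local v)) * x⁻¹) ∂νG)
  -- STEP E: the right-hand side at the representative
  have hE : classOrbitalIntegral mH (fun z : ((cmDatum L 2 (Matrix.of fun i j : Fin 2 => if i.val + j.val + 1 = 2 then (1 : L) else 0)).Local v × (cmDatum L 1 (Matrix.of fun i j : Fin 1 => if i.val + j.val + 1 = 1 then (1 : L) else 0)).Local v) => ∫ x, β x • ψ (x * ((θ z : ↥(Subgroup.centralizer ({ε} : Set ((cmDatum L 3 H').Local v)))) : ((cmDatum L 3 H').Local v)) * x⁻¹) ∂νG) (ConjClasses.mk h) =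
      orbitalIntegral (Quotient.out (ConjClasses.mk h)) ((fun m : ↥(Subgroup.centralizer ({ε} : Set ((cmDatum L 3 H').Local v))) => ∫ x, β x • ψ (x * (m : ((cmDatum L 3 H').Local v)) * x⁻¹) ∂νG) ∘ e) (quotientMeasure (Subgroup.centralizer ({(Quotient.out (ConjClasses.mk h))} : Set ((cmDatum L 2 (Matrix.of fun i j : Fin 2 => if i.val + j.val + 1 = 2 then (1 : L) else 0)).Local v × (cmDatum L 1 (Matrix.of fun i j : Fin 1 => if i.val + j.val + 1 = 1 then (1 : L) else 0)).Local v))) tH hZHc νH) := by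
    rw [classOrbitalIntegral_eq, hmHc]
    congr 1
    funext z
    simp only [Function.comp_apply, heθ]
  -- assembly
  rw [hA, hB', hC', hE, orbitalIntegral_eq_integral_descConj, orbitalIntegral_eq_integral_descConj]
  exact hD'


end CentralSingularDescent

end Summit.HodgeConjecture.HodgeConjecture.Cruxes.H413.K2E3SingularDescentValueAtCentre

end
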